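import Mathlib
import Literature.Barriers.ValiantsHypothesis.AlgebraicNaturalProofs
import Literature.Barriers.ValiantsHypothesis.FullRankMultilinear
import Literature.Barriers.ValiantsHypothesis.FullRankMultilinearCoeff
import Literature.Barriers.ValiantsHypothesis.FullRankMultilinearProofs
import Literature.Computability.AlgebraicComplexity.StandardFamilies
import Literature.Computability.AlgebraicComplexity.DetInVP
import Literature.Computability.AlgebraicComplexity.ArithCircuitProofs
import Summits.ValiantsHypothesis.ValiantsHypothesis.Theorems.BarrierLeverSuccinctHittingSetsForVPStubFullRankSmallCircuit
import Summits.ValiantsHypothesis.ValiantsHypothesis.Theorems.BarrierLeverSuccinctHittingSetsForVPDimensionCount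
import HarnessLib

/-!
# Crux `BarrierLever.SuccinctHittingSetsForVP` (stmt-ValiantsHypothesis-14610), line `registered` —
RAZ'S FULL-RANK DETERMINANTS ARE LEVEL-4 DISTINGUISHERS AND ARE HIT BY `SmallCircuits ℂ (2n) 4`
(lead assembly of wave 6: an explicit, classical family of `poly(N)`-size natural distinguishers —
the `2^n × 2^n` partial-derivative-matrix determinants behind the multilinear-formula lower bounds of
Raz and Raz–Yehudayoff — answers Forbes–Shpilka–Volk's Question 6 "yes" for itself, unconditionally)

**What is proved (unconditional; it does NOT close the item — the open heart `stub_superDense` is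
FSV18 Question 6 itself).** Fix `n` and a balanced partition `A : Fin (2n) ≃ Fin n ⊕ Fin n` of the
variables into `Y ⊔ Z`. Raz's matrix `M_{f^A}` (`pdMatrix (rename A f)`, rows/columns = subsets of
`Y`/`Z`, entry = the coefficient of the multilinear monomial `y^U z^T`) has entries that are
COORDINATES of the coefficient vector of `f` (`coeff_setMonomial_rename`), so its determinant is the
value at `coeff(f)` of ONE polynomial `D_A` in the `N = C(4n, 2n)` coefficient variables: the generic
determinant `detPoly` renamed into the coefficient variables (`eval_coeffVector_razDet`).
* `razDet_mem_distinguishers` : for `n ≥ 10`, `D_A ∈ Distinguishers ℂ (2n) 4` — size `≤ 8 (2^n+1)^7 ≤ N^4`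
  by Berkowitz (`complexity_detPoly_le`, tree file `DetInVP.lean`) and renaming
  (`complexity_rename_le_holds'`), degree `≤ 2^n ≤ N^4`.
* `isSuccinctHittingSet_razDeterminants` : for `n ≥ 10`, `SmallCircuits ℂ (2n) 4` HITS every
  polynomial in the coefficient variables whose value at every coefficient vector is `det M_{f^A}` for
  some balanced `A` (these are exactly the `D_A`): by wave 6's `stub_fullRankSmallCircuit` (p161281)
  one small circuit — the Raz–Yehudayoff polynomial at a generic complex specialisation — has
  `rank M_{f^A} = 2^n`, hence `det M_{f^A} ≠ 0`, for EVERY `A` at once.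
* `not_isNaturalProof_razDeterminant` : consequently no `D_A` is an algebraically natural proof
  against `SmallCircuits ℂ (2n) b`, `b ≥ 4`, for any ambient class `𝒟` — although the very same
  determinants ARE natural proofs against multilinear FORMULAS (Raz 2009) and certify
  `Ω(n²/log² n)` syntactically multilinear circuit size (Alon–Kumar–Volk 2020): in regime `d = n`
  the full-rank method is useless against `VP`, by an explicit small circuit rather than by a
  conditional barrier.
Axioms: `propext`, `Classical.choice`, `Quot.sound`. No new definitions (the distinguisher is the
term `rename (U,T ↦ c_{ind(A⁻¹U ⊔ A⁻¹T)}) detPoly`, kept as an expression).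

References: [ForbesShpilkaVolk2018] M. Forbes, A. Shpilka, B. L. Volk, Theory Comput. 14 (2018),
§1.2 (rank methods are algebraically natural), Cor. 5, Question 6; [RazYehudayoff2008] R. Raz,
A. Yehudayoff, Comput. Complexity 17 (2008), §4.2.2, Thm. 4.2; Raz, J. ACM 56 (2009) (multilinear
formulas for full-rank polynomials); Berkowitz 1984 (`DET ∈ VP`).
-/

-- layout Summits/ValiantsHypothesis/ValiantsHypothesis forces the duplicated namespace component
set_option linter.dupNamespace false

namespace Summit.ValiantsHypothesis.ValiantsHypothesis.Theorems.BarrierLever.SuccinctHittingSetsForVP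

open Literature.Barriers.ValiantsHypothesis Literature.Computability.AlgebraicComplexity
open MvPolynomial Literature.Barriers.ValiantsHypothesis.RazYehudayoff

namespace RazDeterminant

variable {n : ℕ}

/-- The degree of the multilinear exponent vector `ind W` is `|W|`. [folklore] -/
theorem degree_ind {σ : Type*} (W : Finset σ) : (ind W).degree = W.card := by
  classical
  rw [Finsupp.degree_apply, support_ind]
  calc ∑ i ∈ W, (ind W) i = ∑ i ∈ W, 1 := Finset.sum_congr rfl fun i hi => by
        rw [ind_apply, if_pos hi]
    _ = W.card := by simp

/-- The coefficient coordinate read by the `(U, T)` entry of Raz's matrix `M_{f^A}`: the multilinear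
monomial on the positions `A⁻¹(U) ⊔ A⁻¹(T)`, of degree `≤ 2n`. (A term, not a definition of the
tree: used only inside the statements below.) [cite: RazYehudayoff2008, §4.2.2] -/
theorem degree_ind_union_le (A : Fin (2 * n) ≃ Fin n ⊕ Fin n) (U T : Finset (Fin n)) :
    (ind (U.map (eY A) ∪ T.map (eZ A))).degree ≤ 2 * n := by
  rw [degree_ind]
  calc (U.map (eY A) ∪ T.map (eZ A)).card ≤ (Finset.univ : Finset (Fin (2 * n))).card :=
        Finset.card_le_card (Finset.subset_univ _)
    _ = 2 * n := by simp

/-- **The Raz determinant is a polynomial in the coefficient variables**: the value of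
`rename (…) DET` at the coefficient vector of `f` is `det M_{f^A}`.
[cite: RazYehudayoff2008, §4.2.2] -/
theorem eval_coeffVector_razDet (A : Fin (2 * n) ≃ Fin n ⊕ Fin n) (f : MvPolynomial (Fin (2 * n)) ℂ) :
    eval (coeffVector (degLEMonomials (2 * n)) f)
        (rename (fun p : Finset (Fin n) × Finset (Fin n) =>
        (⟨ind (p.1.map (eY A) ∪ p.2.map (eZ A)), degree_ind_union_le A p.1 p.2⟩ : degLEMonomials (2 * n)))
        (detPoly (Finset (Fin n)) ℂ)) =
      (pdMatrix (rename A f)).det := by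
  rw [eval_rename, eval_detPoly]
  congr 1
  ext U T
  simp only [Matrix.of_apply, Function.comp_apply, coeffVector_apply, pdMatrix,
    coeff_setMonomial_rename]

/-- The generic determinant is natural under reindexing of the matrix positions. [folklore] -/
theorem rename_detPoly_equiv {m m' : Type*} [Fintype m] [DecidableEq m] [Fintype m'] [DecidableEq m']
    (e : m' ≃ m) :
    rename (Prod.map e e) (detPoly m' ℂ) = detPoly m ℂ := by
  unfold detPoly
  rw [AlgHom.map_det]
  have h : (rename (Prod.map (⇑e) (⇑e)) : MvPolynomial (m' × m') ℂ →ₐ[ℂ] MvPolynomial (m × m) ℂ).mapMatrix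
      (Matrix.mvPolynomialX m' m' ℂ) = (Matrix.mvPolynomialX m m ℂ).submatrix e e := by
    ext i j
    simp [Matrix.mvPolynomialX_apply, rename_X]
  rw [h, Matrix.det_submatrix_equiv_self]

/-- **Size of the generic `2^n × 2^n` determinant**: `L(DET_{Finset (Fin n)}) ≤ 8 (2^n + 1)^7`
(Berkowitz, via the tree's `complexity_detPoly_le` and reindexing). [cite: ForbesShpilkaVolk2018, §1.2] -/
theorem complexity_detPoly_finset_le (n : ℕ) :
    complexity (detPoly (Finset (Fin n)) ℂ) ≤ 8 * (2 ^ n + 1) ^ 7 := by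
  classical
  have hcard : Fintype.card (Finset (Fin n)) = 2 ^ n := by simp
  let e : Fin (2 ^ n) ≃ Finset (Fin n) := (Fintype.equivFinOfCardEq hcard).symm
  rw [← rename_detPoly_equiv e]
  exact (complexity_rename_le_holds' _ _).trans (complexity_detPoly_le ℂ (2 ^ n))

/-- Size of the Raz determinant as a polynomial in the coefficient variables:
`≤ 8 (2^n + 1)^7`. [cite: ForbesShpilkaVolk2018, §1.2] -/
theorem complexity_razDet_le (A : Fin (2 * n) ≃ Fin n ⊕ Fin n) :
    complexity (rename (fun p : Finset (Fin n) × Finset (Fin n) =>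
        (⟨ind (p.1.map (eY A) ∪ p.2.map (eZ A)), degree_ind_union_le A p.1 p.2⟩ : degLEMonomials (2 * n)))
        (detPoly (Finset (Fin n)) ℂ)) ≤ 8 * (2 ^ n + 1) ^ 7 :=
  (complexity_rename_le_holds' _ _).trans (complexity_detPoly_finset_le n)

/-- Degree of the Raz determinant: `≤ 2^n`. [cite: RazYehudayoff2008, §4.2.2] -/
theorem totalDegree_razDet_le (A : Fin (2 * n) ≃ Fin n ⊕ Fin n) :
    (rename (fun p : Finset (Fin n) × Finset (Fin n) =>
        (⟨ind (p.1.map (eY A) ∪ p.2.map (eZ A)), degree_ind_union_le A p.1 p.2⟩ : degLEMonomials (2 * n)))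
        (detPoly (Finset (Fin n)) ℂ)).totalDegree ≤ 2 ^ n := by
  refine (totalDegree_rename_le _ _).trans ?_
  calc (detPoly (Finset (Fin n)) ℂ).totalDegree ≤ Fintype.card (Finset (Fin n)) :=
        detPoly_isHomogeneous.totalDegree_le
    _ = 2 ^ n := by simp

/-- Arithmetic: `8 (2^n + 1)^7 ≤ (2^(2n))^4` for `n ≥ 10`. [folklore] -/
theorem size_arith {n : ℕ} (hn : 10 ≤ n) : 8 * (2 ^ n + 1) ^ 7 ≤ (2 ^ (2 * n)) ^ 4 := by
  have h1 : 2 ^ n + 1 ≤ 2 ^ (n + 1) := by rw [pow_succ]; have := Nat.one_le_two_pow (n := n); omega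
  have h2 : 8 * (2 ^ n + 1) ^ 7 ≤ 8 * (2 ^ (n + 1)) ^ 7 :=
    Nat.mul_le_mul_left 8 (Nat.pow_le_pow_left h1 7)
  refine h2.trans ?_
  have h3 : 8 * (2 ^ (n + 1)) ^ 7 = 2 ^ (7 * n + 10) := by
    rw [← pow_mul, show (8 : ℕ) = 2 ^ 3 by norm_num, ← pow_add]
    ring_nf
  have h4 : (2 ^ (2 * n)) ^ 4 = 2 ^ (8 * n) := by rw [← pow_mul]; ring_nf
  rw [h3, h4]
  exact Nat.pow_le_pow_right (by norm_num) (by omega)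

/-- `2^(2n) ≤ C(4n, 2n)` for `n ≥ 2` (the tree's `two_pow_le_choose` at `2n`). [folklore] -/
theorem two_pow_two_mul_le_choose {n : ℕ} (hn : 2 ≤ n) :
    2 ^ (2 * n) ≤ Nat.choose (2 * (2 * n)) (2 * n) :=
  LowDegreeEquations.two_pow_le_choose (by omega)

/-- **The Raz determinant is a level-4 distinguisher** for `n ≥ 10`: size `≤ 8(2^n+1)^7 ≤ N^4` and
degree `≤ 2^n ≤ N^4`, `N = C(4n, 2n)`. [cite: ForbesShpilkaVolk2018, Cor. 5 and §1.2] -/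
theorem razDet_mem_distinguishers {n : ℕ} (hn : 10 ≤ n) (A : Fin (2 * n) ≃ Fin n ⊕ Fin n) :
    rename (fun p : Finset (Fin n) × Finset (Fin n) =>
        (⟨ind (p.1.map (eY A) ∪ p.2.map (eZ A)), degree_ind_union_le A p.1 p.2⟩ : degLEMonomials (2 * n)))
        (detPoly (Finset (Fin n)) ℂ) ∈ Distinguishers ℂ (2 * n) 4 := by
  have hN : (2 ^ (2 * n)) ^ 4 ≤ Nat.choose (2 * (2 * n)) (2 * n) ^ 4 :=
    Nat.pow_le_pow_left (two_pow_two_mul_le_choose (by omega)) 4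
  refine ⟨(complexity_razDet_le A).trans ((size_arith hn).trans hN), ?_⟩
  refine (totalDegree_razDet_le A).trans (le_trans ?_ hN)
  calc 2 ^ n ≤ 2 ^ (2 * n) := Nat.pow_le_pow_right (by norm_num) (by omega)
    _ = (2 ^ (2 * n)) ^ 1 := (pow_one _).symm
    _ ≤ (2 ^ (2 * n)) ^ 4 := Nat.pow_le_pow_right (Nat.one_le_two_pow) (by norm_num)

/-- A square matrix over a field whose rank is the full dimension has nonzero determinant. [folklore] -/
theorem det_ne_zero_of_rank_eq_card {ι : Type*} [Fintype ι] [DecidableEq ι] {K : Type*} [Field K]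
    (M : Matrix ι ι K) (h : M.rank = Fintype.card ι) : M.det ≠ 0 := by
  intro hdet
  obtain ⟨v, hv, hMv⟩ := Matrix.exists_mulVec_eq_zero_iff.mpr hdet
  have hker : v ∈ LinearMap.ker M.mulVecLin := by simpa using hMv
  have hk : 1 ≤ Module.finrank K (LinearMap.ker M.mulVecLin) := by
    rw [Nat.one_le_iff_ne_zero]
    intro h0
    have hbot : LinearMap.ker M.mulVecLin = ⊥ := Submodule.finrank_eq_zero.mp h0
    rw [hbot, Submodule.mem_bot] at hker
    exact hv hker
  have hsum := LinearMap.finrank_range_add_finrank_ker M.mulVecLin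
  rw [Module.finrank_fintype_fun_eq_card] at hsum
  have hr : M.rank = Module.finrank K (LinearMap.range M.mulVecLin) := rfl
  omega

end RazDeterminant

open RazDeterminant

/-- **Raz's determinants are hit** (wave 6, lead assembly): for `n ≥ 10` the coefficient vectors of
`SmallCircuits ℂ (2n) 4` hit every polynomial in the `N = C(4n,2n)` coefficient variables whose value
at every coefficient vector is `det M_{f^A}` for some balanced partition `A` — i.e. the Raz
determinants `D_A`, level-4 distinguishers (`razDet_mem_distinguishers`). One small circuit serves all
`A` at once: the Raz–Yehudayoff polynomial at a generic complex point (`stub_fullRankSmallCircuit`,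
p161281). [cite: ForbesShpilkaVolk2018, Question 6 and §1.2] [cite: RazYehudayoff2008, Thm. 4.2] -/
theorem isSuccinctHittingSet_razDeterminants {n : ℕ} (hn : 2 ≤ n) :
    IsSuccinctHittingSet (degLEMonomials (2 * n)) (SmallCircuits ℂ (2 * n) 4)
      {D | ∃ A : Fin (2 * n) ≃ Fin n ⊕ Fin n, ∀ f : MvPolynomial (Fin (2 * n)) ℂ,
        eval (coeffVector (degLEMonomials (2 * n)) f) D = (pdMatrix (rename A f)).det} := by
  classical
  rintro D ⟨A, hA⟩ -
  obtain ⟨f, hf, hfull⟩ := stub_fullRankSmallCircuit n hn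
  refine ⟨f, hf, ?_⟩
  rw [hA f]
  apply det_ne_zero_of_rank_eq_card
  rw [hfull A, Fintype.card_finset, Fintype.card_fin]

/-- **The class is the family of Raz determinants**: for every balanced `A` the level-4 distinguisher
`rename (…) DET` belongs to it (and, `ℂ` being infinite, is its only member for that `A`).
[cite: RazYehudayoff2008, §4.2.2] -/
theorem razDet_mem_class {n : ℕ} (A : Fin (2 * n) ≃ Fin n ⊕ Fin n) :
    rename (fun p : Finset (Fin n) × Finset (Fin n) =>
        (⟨ind (p.1.map (eY A) ∪ p.2.map (eZ A)), degree_ind_union_le A p.1 p.2⟩ : degLEMonomials (2 * n)))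
        (detPoly (Finset (Fin n)) ℂ) ∈
      {D : MvPolynomial (degLEMonomials (2 * n)) ℂ | ∃ A : Fin (2 * n) ≃ Fin n ⊕ Fin n,
        ∀ f : MvPolynomial (Fin (2 * n)) ℂ,
          eval (coeffVector (degLEMonomials (2 * n)) f) D = (pdMatrix (rename A f)).det} :=
  ⟨A, eval_coeffVector_razDet A⟩

/-- **The Raz determinant is a nonzero level-4 distinguisher that does not vanish on
`SmallCircuits ℂ (2n) 4`** (`n ≥ 10`): the instance of FSV Question 6 answered "yes" for this
family. [cite: ForbesShpilkaVolk2018, Question 6] -/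
theorem razDet_hit {n : ℕ} (hn : 10 ≤ n) (A : Fin (2 * n) ≃ Fin n ⊕ Fin n) :
    rename (fun p : Finset (Fin n) × Finset (Fin n) =>
        (⟨ind (p.1.map (eY A) ∪ p.2.map (eZ A)), degree_ind_union_le A p.1 p.2⟩ : degLEMonomials (2 * n)))
        (detPoly (Finset (Fin n)) ℂ) ∈ Distinguishers ℂ (2 * n) 4 ∧
      rename (fun p : Finset (Fin n) × Finset (Fin n) =>
        (⟨ind (p.1.map (eY A) ∪ p.2.map (eZ A)), degree_ind_union_le A p.1 p.2⟩ : degLEMonomials (2 * n)))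
        (detPoly (Finset (Fin n)) ℂ) ≠ 0 ∧
      ∃ f ∈ SmallCircuits ℂ (2 * n) 4,
        eval (coeffVector (degLEMonomials (2 * n)) f)
          (rename (fun p : Finset (Fin n) × Finset (Fin n) =>
        (⟨ind (p.1.map (eY A) ∪ p.2.map (eZ A)), degree_ind_union_le A p.1 p.2⟩ : degLEMonomials (2 * n)))
        (detPoly (Finset (Fin n)) ℂ)) ≠ 0 := by
  classical
  obtain ⟨f, hf, hfull⟩ := stub_fullRankSmallCircuit n (by omega)
  have hne : eval (coeffVector (degLEMonomials (2 * n)) f)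
      (rename (fun p : Finset (Fin n) × Finset (Fin n) =>
        (⟨ind (p.1.map (eY A) ∪ p.2.map (eZ A)), degree_ind_union_le A p.1 p.2⟩ : degLEMonomials (2 * n)))
        (detPoly (Finset (Fin n)) ℂ)) ≠ 0 := by
    rw [eval_coeffVector_razDet]
    apply det_ne_zero_of_rank_eq_card
    rw [hfull A, Fintype.card_finset, Fintype.card_fin]
  refine ⟨razDet_mem_distinguishers hn A, ?_, f, hf, hne⟩
  rintro h0
  rw [h0, map_zero] at hne
  exact hne rfl

/-- **No Raz determinant is an algebraically natural proof against `VP` in regime `d = n`**: for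
`n ≥ 2`, `b ≥ 4`, every balanced partition `A` and every ambient class `𝒟`, a polynomial computing
`det M_{f^A}` on coefficient vectors is NOT a `𝒟`-natural proof against `SmallCircuits ℂ (2n) b`
(FSV Def. 1) — it fails usefulness on an explicit small circuit. [cite: ForbesShpilkaVolk2018, Def. 1 and Thm. 4] -/
theorem not_isNaturalProof_razDeterminant {n b : ℕ} (hn : 2 ≤ n) (hb : 4 ≤ b)
    (A : Fin (2 * n) ≃ Fin n ⊕ Fin n) (𝒟 : Set (MvPolynomial (degLEMonomials (2 * n)) ℂ))
    {D : MvPolynomial (degLEMonomials (2 * n)) ℂ}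
    (hD : ∀ f : MvPolynomial (Fin (2 * n)) ℂ,
      eval (coeffVector (degLEMonomials (2 * n)) f) D = (pdMatrix (rename A f)).det) :
    ¬ IsNaturalProof (degLEMonomials (2 * n)) (SmallCircuits ℂ (2 * n) b) 𝒟 D := by
  classical
  rintro ⟨-, -, hvan⟩
  obtain ⟨f, hf, hfull⟩ := stub_fullRankSmallCircuit n hn
  have hf' : f ∈ SmallCircuits ℂ (2 * n) b := smallCircuits_mono ℂ hb (by omega) hf
  have h0 := hvan f hf'
  rw [hD f] at h0
  exact det_ne_zero_of_rank_eq_card _ (by rw [hfull A, Fintype.card_finset, Fintype.card_fin]) h0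

/-- **Registered stub `stub_razDeterminants`** (crux stmt-ValiantsHypothesis-14610, line `registered`;
lead assembly of wave 6): verbatim `isSuccinctHittingSet_razDeterminants` — for `n ≥ 2`,
`SmallCircuits ℂ (2n) 4` hits every polynomial computing a Raz determinant `det M_{f^A}` on
coefficient vectors. [cite: ForbesShpilkaVolk2018, Question 6 and §1.2] [cite: RazYehudayoff2008, Thm. 4.2] -/
theorem stub_razDeterminants :
    ∀ n : ℕ, 2 ≤ n →
      IsSuccinctHittingSet (degLEMonomials (2 * n)) (SmallCircuits ℂ (2 * n) 4)
        {D | ∃ A : Fin (2 * n) ≃ Fin n ⊕ Fin n, ∀ f : MvPolynomial (Fin (2 * n)) ℂ,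
          MvPolynomial.eval (coeffVector (degLEMonomials (2 * n)) f) D =
            (Literature.Barriers.ValiantsHypothesis.pdMatrix (MvPolynomial.rename A f)).det} :=
  fun _ hn => isSuccinctHittingSet_razDeterminants hn

end Summit.ValiantsHypothesis.ValiantsHypothesis.Theorems.BarrierLever.SuccinctHittingSetsForVP
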